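import Summits.QuantumFields.YangMills.Theses.ConvexGribovBody
import Literature.MathematicalPhysics.QuantumFieldTheory.YangMillsOS
import Literature.MathematicalPhysics.QuantumLattice.GaugeGroupsProofs
import Literature.AlgebraicTopology.FundamentalGroup.RotationGroupSO3
import Mathlib.Topology.Homotopy.Equiv

/-!
# `ConvexGribovBody.BrascampLiebVacuumSC` — negative lane, part 1: an admissible simply-connected
# instance (refuter / standing disprover, crux stmt-QuantumFields-16404)

The restated crux `Summit.QuantumFields.YangMills.Theses.ConvexGribovBody.BrascampLiebVacuumSC`
quantifies over compact simple gauge groups `G` with `IsCompactSimpleLieGroup G` AND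
`SimplyConnectedSpace G`. Every negative lemma of the form `¬ ∀ G, …` about it (part 2,
`Negative/LoadBearingHypotheses.lean`), and every future refutation by instantiation, needs ONE
group for which both hypotheses are CERTIFIED in the tree. This file supplies it:

* `simplyConnectedSpace_su2` — **`SU(2)` is simply connected** (sorry-free; axioms `propext`,
  `Classical.choice`, `Quot.sound`): the polynomial map
  `q = a + bi + cj + dk ↦ [[a + bi, c + di], [−c + di, a − bi]]` is a continuous bijection from the
  unit quaternions `S³ ⊂ ℍ` onto `Matrix.specialUnitaryGroup (Fin 2) ℂ` (onto: a special unitary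
  `2 × 2` matrix has `A₁₁ = conj A₀₀`, `A₁₀ = −conj A₀₁` because `Aᴴ = A⁻¹ = adj A`), hence a
  homeomorphism (compact → Hausdorff, `Continuous.homeoOfEquivCompactToT2`), and `π₁(S³) = 0` is
  the tree's `Literature.AlgebraicTopology.FundamentalGroup.simplyConnectedSpace_sphere_quaternion`
  (Hatcher, *Algebraic Topology*, Prop. 1.14; §3.D for `S³ → SO(3)`); transported by
  `ContinuousMap.HomotopyEquiv.simplyConnectedSpace_iff`.
* admissibility of `SU(2)` (`IsCompactSimpleLieGroup`) is the tree's PROVED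
  `isSimpleCompactGroup_specialUnitaryGroup_holds` + the faithful unitary fundamental representation
  (`isCompactSimpleLieGroup_specialUnitaryGroup`; a named copy `isCompactSimpleLieGroup_su2` is
  already landed in `Theorems/OSLegsFromFemtoAndGap/Negative/UnitsAndGapFree.lean`).
* `exists_admissible_simplyConnected` — **non-vacuity certificate**: the hypotheses of the SC crux
  are satisfiable, so the crux is not true for lack of instances (audit bar D-0015).

Side benefit: discharges the hypothesis `(hSC : SimplyConnectedSpace SU(2))` carried by the sibling
negative lemmas of `Theorems/SusceptibilityToPoincare/Negative/TwistSectorSimplyConnected.lean`.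
Nothing here asserts a Theses statement.
-/

noncomputable section

open Literature.MathematicalPhysics.QuantumFieldTheory

namespace Summit.QuantumFields.YangMills.Theorems.BrascampLiebVacuumSC.Negative

/-! ### `SU(2) ≃ₜ S³` is simply connected -/

section SU2

open Quaternion Matrix Complex

/-- **`SU(2)` is simply connected**: `S³ ≃ₜ SU(2)` by `q ↦ [[a + bi, c + di], [−c + di, a − bi]]`
(continuous bijection, compact → T₂) and `π₁(S³) = 0` (tree, Hatcher Prop. 1.14).
[cite: HatcherAT2002, §1.1 Prop. 1.14 and §3.D] -/
theorem simplyConnectedSpace_su2 : SimplyConnectedSpace (Matrix.specialUnitaryGroup (Fin 2) ℂ) := by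
  -- the map on all of `ℍ`
  let qm : ℍ → Matrix (Fin 2) (Fin 2) ℂ := fun q =>
    !![(q.re : ℂ) + (q.imI : ℂ) * I, (q.imJ : ℂ) + (q.imK : ℂ) * I;
      -(q.imJ : ℂ) + (q.imK : ℂ) * I, (q.re : ℂ) - (q.imI : ℂ) * I]
  have hqm : ∀ q, qm q = !![(q.re : ℂ) + (q.imI : ℂ) * I, (q.imJ : ℂ) + (q.imK : ℂ) * I;
      -(q.imJ : ℂ) + (q.imK : ℂ) * I, (q.re : ℂ) - (q.imI : ℂ) * I] := fun q => rfl
  -- continuity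
  have hcont : Continuous qm := by
    have hre : Continuous fun q : ℍ => (q.re : ℂ) := continuous_ofReal.comp continuous_re
    have hI : Continuous fun q : ℍ => (q.imI : ℂ) := continuous_ofReal.comp continuous_imI
    have hJ : Continuous fun q : ℍ => (q.imJ : ℂ) := continuous_ofReal.comp continuous_imJ
    have hK : Continuous fun q : ℍ => (q.imK : ℂ) := continuous_ofReal.comp continuous_imK
    refine continuous_matrix fun i j => ?_
    fin_cases i <;> fin_cases j
    · show Continuous fun q : ℍ => (q.re : ℂ) + (q.imI : ℂ) * I
      exact hre.add (hI.mul continuous_const)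
    · show Continuous fun q : ℍ => (q.imJ : ℂ) + (q.imK : ℂ) * I
      exact hJ.add (hK.mul continuous_const)
    · show Continuous fun q : ℍ => -(q.imJ : ℂ) + (q.imK : ℂ) * I
      exact hJ.neg.add (hK.mul continuous_const)
    · show Continuous fun q : ℍ => (q.re : ℂ) - (q.imI : ℂ) * I
      exact hre.sub (hI.mul continuous_const)
  -- unitarity and determinant on the unit sphere
  have hunit : ∀ q : ℍ, q.re ^ 2 + q.imI ^ 2 + q.imJ ^ 2 + q.imK ^ 2 = 1 →
      qm q * star (qm q) = 1 := by
    intro q hq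
    have hq' : (q.re : ℂ) ^ 2 + (q.imI : ℂ) ^ 2 + (q.imJ : ℂ) ^ 2 + (q.imK : ℂ) ^ 2 = 1 := by
      exact_mod_cast hq
    ext i j
    rw [Matrix.star_eq_conjTranspose, hqm]
    fin_cases i <;> fin_cases j <;>
      simp [Matrix.mul_apply, Fin.sum_univ_two, Matrix.conjTranspose_apply,
        Complex.conj_ofReal] <;> ring_nf <;> rw [Complex.I_sq] <;> linear_combination hq'
  have hdet : ∀ q : ℍ, q.re ^ 2 + q.imI ^ 2 + q.imJ ^ 2 + q.imK ^ 2 = 1 → (qm q).det = 1 := by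
    intro q hq
    have hq' : (q.re : ℂ) ^ 2 + (q.imI : ℂ) ^ 2 + (q.imJ : ℂ) ^ 2 + (q.imK : ℂ) ^ 2 = 1 := by
      exact_mod_cast hq
    rw [hqm, Matrix.det_fin_two_of]
    ring_nf
    rw [Complex.I_sq]
    linear_combination hq'
  have hsq : ∀ q : Metric.sphere (0 : ℍ) 1,
      (q : ℍ).re ^ 2 + (q : ℍ).imI ^ 2 + (q : ℍ).imJ ^ 2 + (q : ℍ).imK ^ 2 = 1 := fun q => by
    rw [← Quaternion.normSq_def']
    exact Literature.AlgebraicTopology.FundamentalGroup.normSq_coe_sphere q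
  have hmem : ∀ q : Metric.sphere (0 : ℍ) 1, qm q ∈ Matrix.specialUnitaryGroup (Fin 2) ℂ := by
    intro q
    rw [Matrix.mem_specialUnitaryGroup_iff, Matrix.mem_unitaryGroup_iff]
    exact ⟨hunit q (hsq q), hdet q (hsq q)⟩
  -- the map `S³ → SU(2)`
  let f : Metric.sphere (0 : ℍ) 1 → Matrix.specialUnitaryGroup (Fin 2) ℂ :=
    fun q => ⟨qm q, hmem q⟩
  have hf : Continuous f := Continuous.subtype_mk (hcont.comp continuous_subtype_val) _
  have hinj : Function.Injective f := by
    intro p q h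
    have h' : qm p = qm q := congrArg Subtype.val h
    rw [hqm, hqm] at h'
    have h00 := congrFun (congrFun h' 0) 0
    have h01 := congrFun (congrFun h' 0) 1
    simp only [Matrix.of_apply, Matrix.cons_val', Matrix.cons_val_zero,
      Matrix.cons_val_one, Matrix.cons_val_fin_one, Matrix.empty_val'] at h00 h01
    have e1 := congrArg Complex.re h00
    have e2 := congrArg Complex.im h00
    have e3 := congrArg Complex.re h01
    have e4 := congrArg Complex.im h01
    simp at e1 e2 e3 e4
    apply Subtype.ext
    ext
    exacts [e1, e2, e3, e4]
  have hsurj : Function.Surjective f := by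
    intro A
    obtain ⟨hU, hdA⟩ := Matrix.mem_specialUnitaryGroup_iff.1 A.2
    -- entries of a special unitary 2×2 matrix
    have h1 : star A.1 * A.1 = 1 := Matrix.mem_unitaryGroup_iff'.1 hU
    have hsa : star A.1 = A.1.adjugate := by
      rw [← Matrix.inv_eq_left_inv h1, Matrix.inv_def, hdA, Ring.inverse_one, one_smul]
    rw [Matrix.adjugate_fin_two] at hsa
    have e00 := congrFun (congrFun hsa 0) 0
    have e10 := congrFun (congrFun hsa 1) 0
    simp only [Matrix.star_apply, Matrix.of_apply, Matrix.cons_val', Matrix.cons_val_zero,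
      Matrix.cons_val_one, Matrix.cons_val_fin_one, Matrix.empty_val'] at e00 e10
    have h11 : A.1 1 1 = starRingEnd ℂ (A.1 0 0) := by rw [← e00]; rfl
    have h10 : A.1 1 0 = -starRingEnd ℂ (A.1 0 1) := by
      have : A.1 1 0 = -(star (A.1 0 1)) := by rw [e10]; ring
      rw [this]; rfl
    -- the norm condition
    have hn : Complex.normSq (A.1 0 0) + Complex.normSq (A.1 0 1) = 1 := by
      have h2 : A.1 * star A.1 = 1 := Matrix.mem_unitaryGroup_iff.1 hU
      have e := congrFun (congrFun h2 0) 0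
      simp only [Matrix.mul_apply, Fin.sum_univ_two, Matrix.star_apply, Matrix.one_apply_eq] at e
      have e' := congrArg Complex.re e
      simp only [Complex.add_re, Complex.one_re] at e'
      rw [Complex.mul_re, Complex.mul_re] at e'
      simp only [Complex.star_def, Complex.conj_re, Complex.conj_im] at e'
      rw [Complex.normSq_apply, Complex.normSq_apply]
      linarith
    set x := A.1 0 0 with hx
    set y := A.1 0 1 with hy
    let q : ℍ := ⟨x.re, x.im, y.re, y.im⟩
    have hq : q.re ^ 2 + q.imI ^ 2 + q.imJ ^ 2 + q.imK ^ 2 = 1 := by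
      show x.re ^ 2 + x.im ^ 2 + y.re ^ 2 + y.im ^ 2 = 1
      rw [Complex.normSq_apply, Complex.normSq_apply] at hn
      nlinarith
    have hqmem : q ∈ Metric.sphere (0 : ℍ) 1 := by
      rw [mem_sphere_zero_iff_norm]
      have h2 : ‖q‖ * ‖q‖ = 1 := by
        rw [← Quaternion.normSq_eq_norm_mul_self, Quaternion.normSq_def']; exact hq
      nlinarith [norm_nonneg q]
    refine ⟨⟨q, hqmem⟩, Subtype.ext ?_⟩
    show qm q = A.1
    rw [hqm]
    ext i j
    fin_cases i <;> fin_cases j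
    · show (x.re : ℂ) + (x.im : ℂ) * I = A.1 0 0
      rw [hx]; exact Complex.re_add_im _
    · show (y.re : ℂ) + (y.im : ℂ) * I = A.1 0 1
      rw [hy]; exact Complex.re_add_im _
    · show -(y.re : ℂ) + (y.im : ℂ) * I = A.1 1 0
      rw [h10]
      apply Complex.ext <;> simp [hy]
    · show (x.re : ℂ) - (x.im : ℂ) * I = A.1 1 1
      rw [h11]
      apply Complex.ext <;> simp [hx]
  -- homeomorphism and transport of simple connectivity
  let e : Metric.sphere (0 : ℍ) 1 ≃ₜ Matrix.specialUnitaryGroup (Fin 2) ℂ :=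
    Continuous.homeoOfEquivCompactToT2 (f := Equiv.ofBijective f ⟨hinj, hsurj⟩) hf
  exact e.toHomotopyEquiv.simplyConnectedSpace_iff.1 inferInstance

/-- **Non-vacuity of the SC crux's hypotheses**: there is a simply-connected admissible gauge group
with a faithful unitary lattice representation (`SU(2)`, fundamental), so
`ConvexGribovBody.BrascampLiebVacuumSC` is not true for lack of instances. [folklore] -/
theorem exists_admissible_simplyConnected :
    ∃ (G : Type) (_ : Group G) (_ : TopologicalSpace G) (_ : IsTopologicalGroup G)
      (_ : CompactSpace G) (_ : MeasurableSpace G) (_ : BorelSpace G),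
      IsCompactSimpleLieGroup G ∧ SimplyConnectedSpace G ∧ Nonempty (LatticeRep G) := by
  have hSU : IsCompactSimpleLieGroup (Matrix.specialUnitaryGroup (Fin 2) ℂ) :=
    isCompactSimpleLieGroup_specialUnitaryGroup
      Literature.MathematicalPhysics.QuantumLattice.isSimpleCompactGroup_specialUnitaryGroup_holds le_rfl
  exact ⟨Matrix.specialUnitaryGroup (Fin 2) ℂ, inferInstance, inferInstance, inferInstance,
    inferInstance, borel _, ⟨rfl⟩, hSU, simplyConnectedSpace_su2, hSU.2⟩

end SU2

end Summit.QuantumFields.YangMills.Theorems.BrascampLiebVacuumSC.Negative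

end
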